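import Mathlib
import HarnessLib

/-!
HONEST FRAMING: exact (Metropolis-corrected) sampling algorithms for lattice gauge theory; figures
of merit are autocorrelation/cost numbers at stated couplings and volumes; no continuum-physics
claim.

# PersistentPairConstants — THE CONSTANTS OF THE (COLD `u`-COUNT, HUB INDICATOR) PAIR WITH PERSISTENCE (`c̄ = pα + (1−p)β`, `g⋆ = pα/c̄`, `D₀ = (1−σ) + σαβ/c̄`,
# `Λ = σ(1−σ)c̄/D₀`, `γ = σ(β−α)/D₀`, `c = σ/D₀`), THE TWO RATIONAL IDENTITIES THAT MAKE THE `O(1)` PART OF THE APPROXIMATE EIGENFUNCTION'S DEFECT VANISH IDENTICALLY,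
# AND THE ELEMENTARY TAYLOR ∕ REMAINDER BOUNDS FILE 3b CONSUMES (lean-2 GEN-46, ours)

Venture-side (OURS).  Cell `lqcd-flow` (pub-lqcd), unit `pub-lqcd-lean-2-g46`, 2026-08-31.  Chapter AF (the law-free `½·log K` with persistence), file 3a — pure real arithmetic, no
chain.  Parameters: swap odds `0 < σ < 1`, acceptances `α = acc(u,·) ∈ (0,1]` (hub `u` onto a cold non-`u` particle), `β = acc(·,u) ∈ (0,1]`, hub law `p = μ_0(u) ∈ (0,1)`.
Averaging the fast hub indicator over the slow cold `u`-count `G = gK` gives, for a statistic `K·h(g) + 𝟙{hub = u}·k(g)`, the two first-order conditions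
`σα(1−g)(h′ − k) − (1−σ)(1−p)k + Λh = 0` (hub `= u`) and `−σβg(h′ − k) + (1−σ)pk + Λh = 0` (hub `≠ u`); their regular solution at rate `Λ = σ(1−σ)c̄/D₀` is
`h = (g − g⋆)e^{γ(g−g⋆)}`, `k = c·A(g)·e^{γ(g−g⋆)}` with `A(g) = α(1−g) + βg` — and with these closed forms (`h′ = (1 + γ(g−g⋆))e^{γ(g−g⋆)}`) both conditions hold
IDENTICALLY in `g` (`pairEigen_identity_one` ∕ `_zero`: `field_simp; ring` after clearing `c̄` and `(1−σ)c̄ + σαβ`).  Hypothesis-equations, no definitions.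

* §1 `pairEigen_cbar_pos` (`0 < c̄ ≤ 1`), `pairEigen_gs_bounds` (`0 < g⋆ < 1`), `pairEigen_D0_bounds` (`1−σ ≤ D₀ ≤ 1`), `pairEigen_c_bounds` (`0 < c ≤ σ/(1−σ)`), `pairEigen_Λ_bounds`
  (`0 < Λ ≤ c`, `Λ < 1`), `pairEigen_abs_γ_le_c` (`|γ| ≤ c`), `pairEigen_A_bounds` (`0 < A ≤ 1`); §2 **`pairEigen_identity_one`**, **`pairEigen_identity_zero`**; §3 `pairEigen_exp_small`
  (`|e^s − 1 − s| ≤ s²`, `|e^s − 1| ≤ 2|s|`, `e^s ≤ 3` for `|s| ≤ 1`), `pairEigen_weight_bounds` (`e^{−c} ≤ e^{γ(G−g⋆K)/K} ≤ e^c`), `pairEigen_rem_one`, `pairEigen_rem_zero`,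
  `pairEigen_jump_core` (the three remainder estimates with the exponentials as free reals).

Reading (no numerics implied): bookkeeping for file 3b.  Literature grade (cell rule): OWN, elementary; nothing cited; no new bib keys.
-/

noncomputable section

namespace Summit.Ventures.LatticeQCDFlow.Scaling

section PairEigen
variable {K : ℕ} {σ α β p cbar gs D0 Λ γ c : ℝ} {f κ : ℕ → ℝ}

/-! ## §1 The constants -/

/-- `0 < c̄ ≤ 1`. [ours] -/
theorem pairEigen_cbar_pos (hα0 : 0 < α) (hα1 : α ≤ 1) (hβ0 : 0 < β) (hβ1 : β ≤ 1) (hp0 : 0 < p) (hp1 : p < 1) (hcbar : cbar = p * α + (1 - p) * β) :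
    0 < cbar ∧ cbar ≤ 1 := by
  subst hcbar; constructor <;> nlinarith

/-- `0 < g⋆ < 1`. [ours] -/
theorem pairEigen_gs_bounds (hα0 : 0 < α) (hα1 : α ≤ 1) (hβ0 : 0 < β) (hβ1 : β ≤ 1) (hp0 : 0 < p) (hp1 : p < 1) (hcbar : cbar = p * α + (1 - p) * β)
    (hgs : gs = p * α / cbar) : 0 < gs ∧ gs < 1 := by
  have hc := pairEigen_cbar_pos hα0 hα1 hβ0 hβ1 hp0 hp1 hcbar
  subst hgs
  refine ⟨div_pos (mul_pos hp0 hα0) hc.1, ?_⟩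
  rw [div_lt_one hc.1, hcbar]; nlinarith

/-- `αβ ≤ c̄`, so `1−σ ≤ D₀ ≤ 1` and `0 < D₀`. [ours] -/
theorem pairEigen_D0_bounds (hσ0 : 0 < σ) (hσ1 : σ < 1) (hα0 : 0 < α) (hα1 : α ≤ 1) (hβ0 : 0 < β) (hβ1 : β ≤ 1) (hp0 : 0 < p) (hp1 : p < 1)
    (hcbar : cbar = p * α + (1 - p) * β) (hD0 : D0 = (1 - σ) + σ * α * β / cbar) : 1 - σ ≤ D0 ∧ D0 ≤ 1 ∧ 0 < D0 := by
  have hc := pairEigen_cbar_pos hα0 hα1 hβ0 hβ1 hp0 hp1 hcbar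
  have hab : α * β ≤ cbar := by
    have e : cbar - α * β = p * α * (1 - β) + (1 - p) * β * (1 - α) := by rw [hcbar]; ring
    nlinarith [mul_nonneg (mul_nonneg hp0.le hα0.le) (sub_nonneg.mpr hβ1), mul_nonneg (mul_nonneg (sub_nonneg.mpr hp1.le) hβ0.le) (sub_nonneg.mpr hα1)]
  have h1 : 0 ≤ σ * α * β / cbar := by have := hc.1; positivity
  have h2 : σ * α * β / cbar ≤ σ := by
    rw [div_le_iff₀ hc.1]; nlinarith
  subst hD0
  refine ⟨by linarith, by linarith, by linarith⟩

/-- `0 < c`, `c ≤ σ/(1−σ)`. [ours] -/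
theorem pairEigen_c_bounds (hσ0 : 0 < σ) (hσ1 : σ < 1) (hα0 : 0 < α) (hα1 : α ≤ 1) (hβ0 : 0 < β) (hβ1 : β ≤ 1) (hp0 : 0 < p) (hp1 : p < 1)
    (hcbar : cbar = p * α + (1 - p) * β) (hD0 : D0 = (1 - σ) + σ * α * β / cbar) (hc : c = σ / D0) : 0 < c ∧ c ≤ σ / (1 - σ) := by
  have hD := pairEigen_D0_bounds hσ0 hσ1 hα0 hα1 hβ0 hβ1 hp0 hp1 hcbar hD0
  subst hc
  exact ⟨div_pos hσ0 hD.2.2, div_le_div_of_nonneg_left hσ0.le (by linarith) hD.1⟩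

/-- `0 < Λ`, `Λ ≤ c`, `Λ < 1` (indeed `Λ ≤ σc̄`). [ours] -/
theorem pairEigen_Λ_bounds (hσ0 : 0 < σ) (hσ1 : σ < 1) (hα0 : 0 < α) (hα1 : α ≤ 1) (hβ0 : 0 < β) (hβ1 : β ≤ 1) (hp0 : 0 < p) (hp1 : p < 1)
    (hcbar : cbar = p * α + (1 - p) * β) (hD0 : D0 = (1 - σ) + σ * α * β / cbar) (hΛ : Λ = σ * (1 - σ) * cbar / D0) (hc : c = σ / D0) :
    0 < Λ ∧ Λ ≤ c ∧ Λ < 1 := by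
  have hcb := pairEigen_cbar_pos hα0 hα1 hβ0 hβ1 hp0 hp1 hcbar
  have hD := pairEigen_D0_bounds hσ0 hσ1 hα0 hα1 hβ0 hβ1 hp0 hp1 hcbar hD0
  have e : Λ = c * ((1 - σ) * cbar) := by rw [hΛ, hc]; field_simp
  have hcc := pairEigen_c_bounds hσ0 hσ1 hα0 hα1 hβ0 hβ1 hp0 hp1 hcbar hD0 hc
  have h1 : (1 - σ) * cbar ≤ 1 := by nlinarith
  have h2 : 0 < (1 - σ) * cbar := mul_pos (by linarith) hcb.1
  refine ⟨by rw [e]; exact mul_pos hcc.1 h2, by rw [e]; nlinarith [hcc.1], ?_⟩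
  -- `Λ = σ(1−σ)c̄/D₀ ≤ σ(1−σ)c̄/(1−σ) = σc̄ < 1`
  rw [hΛ, div_lt_one hD.2.2]
  nlinarith [mul_pos hσ0 h2]

/-- `|γ| ≤ c`. [ours] -/
theorem pairEigen_abs_γ_le_c (hσ0 : 0 < σ) (hσ1 : σ < 1) (hα0 : 0 < α) (hα1 : α ≤ 1) (hβ0 : 0 < β) (hβ1 : β ≤ 1) (hp0 : 0 < p) (hp1 : p < 1)
    (hcbar : cbar = p * α + (1 - p) * β) (hD0 : D0 = (1 - σ) + σ * α * β / cbar) (hγ : γ = σ * (β - α) / D0) (hc : c = σ / D0) : |γ| ≤ c := by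
  have hD := pairEigen_D0_bounds hσ0 hσ1 hα0 hα1 hβ0 hβ1 hp0 hp1 hcbar hD0
  rw [hγ, hc, abs_div, abs_of_pos hD.2.2]
  refine div_le_div_of_nonneg_right ?_ hD.2.2.le
  rw [abs_mul, abs_of_pos hσ0]
  have : |β - α| ≤ 1 := abs_le.mpr ⟨by linarith, by linarith⟩
  nlinarith

/-- `A(G/K) = (α(K−G) + βG)/K ∈ [min… , 1]`: `0 < A ≤ 1` for `G ≤ K`, `K ≥ 1`. [ours] -/
theorem pairEigen_A_bounds (hα0 : 0 < α) (hα1 : α ≤ 1) (hβ0 : 0 < β) (hβ1 : β ≤ 1) (hK : 1 ≤ K) {G : ℕ} (hG : G ≤ K) :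
    0 < (α * ((K : ℝ) - G) + β * G) / K ∧ (α * ((K : ℝ) - G) + β * G) / K ≤ 1 := by
  have hK0 : (0 : ℝ) < K := by exact_mod_cast (show 0 < K by omega)
  have hGK : (G : ℝ) ≤ K := by exact_mod_cast hG
  have hG0 : (0 : ℝ) ≤ G := Nat.cast_nonneg G
  constructor
  · apply div_pos _ hK0
    rcases Nat.eq_zero_or_pos G with h0 | hpos
    · subst h0; simp; nlinarith
    · have : (0 : ℝ) < G := by exact_mod_cast hpos
      nlinarith
  · rw [div_le_one hK0]; nlinarith

/-! ## §2 The two identities (the `O(1)` terms cancel identically in `g`) -/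

/-- **HUB `= u`:** `σα(1−g)(1 + γ(g−g⋆) − cA(g)) − (1−σ)(1−p)cA(g) + Λ(g−g⋆) = 0` for every real `g`. [ours] -/
theorem pairEigen_identity_one (hσ0 : 0 < σ) (hσ1 : σ < 1) (hα0 : 0 < α) (hβ0 : 0 < β) (hp0 : 0 < p) (hp1 : p < 1)
    (hcbar : cbar = p * α + (1 - p) * β) (hgs : gs = p * α / cbar) (hD0 : D0 = (1 - σ) + σ * α * β / cbar) (hΛ : Λ = σ * (1 - σ) * cbar / D0)
    (hγ : γ = σ * (β - α) / D0) (hc : c = σ / D0) (g : ℝ) :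
    σ * α * (1 - g) * (1 + γ * (g - gs) - c * (α * (1 - g) + β * g)) - (1 - σ) * (1 - p) * (c * (α * (1 - g) + β * g)) + Λ * (g - gs) = 0 := by
  have hcb0 : 0 < cbar := by rw [hcbar]; nlinarith
  set N : ℝ := (1 - σ) * cbar + σ * α * β with hN_def
  have hN0 : 0 < N := by rw [hN_def]; nlinarith [mul_pos hα0 hβ0]
  have hcb : cbar ≠ 0 := hcb0.ne'
  have hN : N ≠ 0 := hN0.ne'
  have hD0' : D0 = N / cbar := by rw [hD0, hN_def]; field_simp
  have hc' : c = σ * cbar / N := by rw [hc, hD0']; field_simp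
  have hγ' : γ = σ * (β - α) * cbar / N := by rw [hγ, hD0']; field_simp
  have hΛ' : Λ = σ * (1 - σ) * cbar * cbar / N := by rw [hΛ, hD0']; field_simp
  rw [hc', hγ', hΛ', hgs]
  field_simp
  rw [hN_def, hcbar]
  ring

/-- **HUB `≠ u`:** `σβg(−1 − γ(g−g⋆) + cA(g)) + (1−σ)pcA(g) + Λ(g−g⋆) = 0` for every real `g`. [ours] -/
theorem pairEigen_identity_zero (hσ0 : 0 < σ) (hσ1 : σ < 1) (hα0 : 0 < α) (hβ0 : 0 < β) (hp0 : 0 < p) (hp1 : p < 1)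
    (hcbar : cbar = p * α + (1 - p) * β) (hgs : gs = p * α / cbar) (hD0 : D0 = (1 - σ) + σ * α * β / cbar) (hΛ : Λ = σ * (1 - σ) * cbar / D0)
    (hγ : γ = σ * (β - α) / D0) (hc : c = σ / D0) (g : ℝ) :
    σ * β * g * (-1 - γ * (g - gs) + c * (α * (1 - g) + β * g)) + (1 - σ) * p * (c * (α * (1 - g) + β * g)) + Λ * (g - gs) = 0 := by
  have hcb0 : 0 < cbar := by rw [hcbar]; nlinarith
  set N : ℝ := (1 - σ) * cbar + σ * α * β with hN_def
  have hN0 : 0 < N := by rw [hN_def]; nlinarith [mul_pos hα0 hβ0]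
  have hcb : cbar ≠ 0 := hcb0.ne'
  have hN : N ≠ 0 := hN0.ne'
  have hD0' : D0 = N / cbar := by rw [hD0, hN_def]; field_simp
  have hc' : c = σ * cbar / N := by rw [hc, hD0']; field_simp
  have hγ' : γ = σ * (β - α) * cbar / N := by rw [hγ, hD0']; field_simp
  have hΛ' : Λ = σ * (1 - σ) * cbar * cbar / N := by rw [hΛ, hD0']; field_simp
  rw [hc', hγ', hΛ', hgs]
  field_simp
  rw [hN_def, hcbar]
  ring

/-! ## §3 Taylor pieces and the remainder estimates -/

/-- Taylor pieces for `e^{s}` with `|s| ≤ 1`: `e^s = 1 + s + r`, `|r| ≤ s²`; `|e^s − 1| ≤ 2|s|`; `e^s ≤ 3`. [ours] -/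
theorem pairEigen_exp_small {s : ℝ} (hs : |s| ≤ 1) :
    |Real.exp s - 1 - s| ≤ s ^ 2 ∧ |Real.exp s - 1| ≤ 2 * |s| ∧ Real.exp s ≤ 3 := by
  refine ⟨Real.abs_exp_sub_one_sub_id_le hs, Real.abs_exp_sub_one_le hs, ?_⟩
  have h1 : s ≤ 1 := (abs_le.mp hs).2
  calc Real.exp s ≤ Real.exp 1 := Real.exp_le_exp.mpr h1
    _ ≤ 3 := by have := Real.exp_one_lt_d9; linarith

/-- The weight `e^{γ(G − g⋆K)/K}` lies in `[e^{−c}, e^{c}]` for `G ≤ K` (`|γ| ≤ c`, `0 ≤ g⋆ ≤ 1`). [ours] -/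
theorem pairEigen_weight_bounds (hK : 1 ≤ K) {G : ℕ} (hG : G ≤ K) (hgs0 : 0 ≤ gs) (hgs1 : gs ≤ 1) (hγc : |γ| ≤ c) :
    Real.exp (-c) ≤ Real.exp (γ * (((G : ℝ) - gs * K) / K)) ∧ Real.exp (γ * (((G : ℝ) - gs * K) / K)) ≤ Real.exp c
      ∧ |((G : ℝ) - gs * K) / K| ≤ 1 := by
  have hK0 : (0 : ℝ) < K := by exact_mod_cast (show 0 < K by omega)
  have hGK : (G : ℝ) ≤ K := by exact_mod_cast hG
  have hG0 : (0 : ℝ) ≤ G := Nat.cast_nonneg G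
  have ht : |((G : ℝ) - gs * K) / K| ≤ 1 := by
    rw [abs_div, abs_of_pos hK0, div_le_one hK0]
    exact abs_le.mpr ⟨by nlinarith, by nlinarith⟩
  have hprod : |γ * (((G : ℝ) - gs * K) / K)| ≤ c := by
    rw [abs_mul]
    calc |γ| * |((G : ℝ) - gs * K) / K| ≤ c * 1 := mul_le_mul hγc ht (abs_nonneg _) (le_trans (abs_nonneg _) hγc)
      _ = c := mul_one c
  have h := abs_le.mp hprod
  exact ⟨Real.exp_le_exp.mpr h.1, Real.exp_le_exp.mpr h.2, ht⟩

/-- **REMAINDER, HUB `= u`** (exponentials as free reals): `0 ≤ s ≤ 1`, `|γ| ≤ c`, `|y+1| ≤ K+1`, `|r| ≤ (γ/K)²`, `0 ≤ L ≤ c²`, `K ≥ 1` ⇒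
`|s(γ/K + (y+1)r) + L/K| ≤ (c + 3c²)/K`. [ours] -/
theorem pairEigen_rem_one {K s γ c y r L : ℝ} (hK : 1 ≤ K) (hs0 : 0 ≤ s) (hs1 : s ≤ 1) (hγc : |γ| ≤ c) (hy : |y + 1| ≤ K + 1) (hr : |r| ≤ (γ / K) ^ 2)
    (hL0 : 0 ≤ L) (hL : L ≤ c ^ 2) : |s * (γ / K + (y + 1) * r) + L / K| ≤ (c + 3 * c ^ 2) / K := by
  have hK0 : 0 < K := by linarith
  have hγ2 : γ ^ 2 ≤ c ^ 2 := by rw [← sq_abs]; exact pow_le_pow_left₀ (abs_nonneg _) hγc 2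
  have h1 : |γ / K| ≤ c / K := by rw [abs_div, abs_of_pos hK0]; exact div_le_div_of_nonneg_right hγc hK0.le
  have h2 : |(y + 1) * r| ≤ 2 * c ^ 2 / K := by
    rw [abs_mul]
    calc |y + 1| * |r| ≤ (K + 1) * (γ / K) ^ 2 := mul_le_mul hy hr (abs_nonneg _) (by positivity)
      _ = (K + 1) / K ^ 2 * γ ^ 2 := by rw [div_pow]; ring
      _ ≤ 2 / K * c ^ 2 := by
          have : (K + 1) / K ^ 2 ≤ 2 / K := by rw [div_le_div_iff₀ (by positivity) hK0]; nlinarith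
          exact mul_le_mul this hγ2 (sq_nonneg _) (by positivity)
      _ = 2 * c ^ 2 / K := by ring
  have h3 : |s * (γ / K + (y + 1) * r)| ≤ (c + 2 * c ^ 2) / K := by
    rw [abs_mul, abs_of_nonneg hs0]
    calc s * |γ / K + (y + 1) * r| ≤ 1 * (c / K + 2 * c ^ 2 / K) :=
          mul_le_mul hs1 (le_trans (abs_add_le _ _) (add_le_add h1 h2)) (abs_nonneg _) zero_le_one
      _ = (c + 2 * c ^ 2) / K := by ring
  have h4 : |L / K| ≤ c ^ 2 / K := by rw [abs_of_nonneg (div_nonneg hL0 hK0.le)]; exact div_le_div_of_nonneg_right hL hK0.le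
  calc |s * (γ / K + (y + 1) * r) + L / K| ≤ |s * (γ / K + (y + 1) * r)| + |L / K| := abs_add_le _ _
    _ ≤ (c + 2 * c ^ 2) / K + c ^ 2 / K := add_le_add h3 h4
    _ = (c + 3 * c ^ 2) / K := by ring

/-- **REMAINDER, HUB `≠ u`** (exponentials as free reals): `0 ≤ s ≤ 1`, `|γ| ≤ c`, `|y−1| ≤ K+1`, `|r| ≤ (γ/K)²`, `|d| ≤ 2|γ/K|`, `0 ≤ m ≤ 3`, `0 ≤ L ≤ c`, `|b| ≤ 1`, `K ≥ 1` ⇒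
`|s(γ/K + (y−1)r + Ld − c(b/K)m)| ≤ (4c + 4c²)/K`. [ours] -/
theorem pairEigen_rem_zero {K s γ c y r d m L b : ℝ} (hK : 1 ≤ K) (hs0 : 0 ≤ s) (hs1 : s ≤ 1) (hγc : |γ| ≤ c) (hy : |y - 1| ≤ K + 1) (hr : |r| ≤ (γ / K) ^ 2)
    (hd : |d| ≤ 2 * |γ / K|) (hm0 : 0 ≤ m) (hm : m ≤ 3) (hL0 : 0 ≤ L) (hL : L ≤ c) (hb : |b| ≤ 1) :
    |s * (γ / K + (y - 1) * r + L * d - c * (b / K) * m)| ≤ (4 * c + 4 * c ^ 2) / K := by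
  have hK0 : 0 < K := by linarith
  have hc0 : 0 ≤ c := le_trans (abs_nonneg _) hγc
  have hγ2 : γ ^ 2 ≤ c ^ 2 := by rw [← sq_abs]; exact pow_le_pow_left₀ (abs_nonneg _) hγc 2
  have h1 : |γ / K| ≤ c / K := by rw [abs_div, abs_of_pos hK0]; exact div_le_div_of_nonneg_right hγc hK0.le
  have h2 : |(y - 1) * r| ≤ 2 * c ^ 2 / K := by
    rw [abs_mul]
    calc |y - 1| * |r| ≤ (K + 1) * (γ / K) ^ 2 := mul_le_mul hy hr (abs_nonneg _) (by positivity)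
      _ = (K + 1) / K ^ 2 * γ ^ 2 := by rw [div_pow]; ring
      _ ≤ 2 / K * c ^ 2 := by
          have : (K + 1) / K ^ 2 ≤ 2 / K := by rw [div_le_div_iff₀ (by positivity) hK0]; nlinarith
          exact mul_le_mul this hγ2 (sq_nonneg _) (by positivity)
      _ = 2 * c ^ 2 / K := by ring
  have h3 : |L * d| ≤ 2 * c ^ 2 / K := by
    rw [abs_mul, abs_of_nonneg hL0]
    calc L * |d| ≤ c * (2 * (c / K)) := mul_le_mul hL (le_trans hd (by linarith)) (abs_nonneg _) hc0
      _ = 2 * c ^ 2 / K := by ring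
  have h4 : |c * (b / K) * m| ≤ 3 * c / K := by
    rw [abs_mul, abs_mul, abs_of_nonneg hc0, abs_div, abs_of_pos hK0, abs_of_nonneg hm0]
    calc c * (|b| / K) * m ≤ c * (1 / K) * 3 := mul_le_mul (mul_le_mul_of_nonneg_left (div_le_div_of_nonneg_right hb hK0.le) hc0) hm hm0 (by positivity)
      _ = 3 * c / K := by ring
  have hin : |γ / K + (y - 1) * r + L * d - c * (b / K) * m| ≤ (4 * c + 4 * c ^ 2) / K := by
    calc |γ / K + (y - 1) * r + L * d - c * (b / K) * m| ≤ |γ / K + (y - 1) * r + L * d| + |c * (b / K) * m| := abs_sub _ _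
      _ ≤ (|γ / K + (y - 1) * r| + |L * d|) + |c * (b / K) * m| := by linarith [abs_add_le (γ / K + (y - 1) * r) (L * d)]
      _ ≤ ((|γ / K| + |(y - 1) * r|) + |L * d|) + |c * (b / K) * m| := by linarith [abs_add_le (γ / K) ((y - 1) * r)]
      _ ≤ ((c / K + 2 * c ^ 2 / K) + 2 * c ^ 2 / K) + 3 * c / K := by linarith
      _ = (4 * c + 4 * c ^ 2) / K := by ring
  rw [abs_mul, abs_of_nonneg hs0]
  calc s * |γ / K + (y - 1) * r + L * d - c * (b / K) * m| ≤ 1 * ((4 * c + 4 * c ^ 2) / K) := mul_le_mul hs1 hin (abs_nonneg _) zero_le_one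
    _ = (4 * c + 4 * c ^ 2) / K := one_mul _

/-- **JUMP CORE** (exponentials as free reals): `|γ| ≤ c`, `|t| ≤ 1`, `|y+1| ≤ K+1`, `|r| ≤ (γ/K)²`, `K ≥ 1` ⇒ `|1 + γt + γ/K + (y+1)r| ≤ 2(1+c)²`. [ours] -/
theorem pairEigen_jump_core {K γ c t y r : ℝ} (hK : 1 ≤ K) (hγc : |γ| ≤ c) (ht : |t| ≤ 1) (hy : |y + 1| ≤ K + 1) (hr : |r| ≤ (γ / K) ^ 2) :
    |1 + γ * t + γ / K + (y + 1) * r| ≤ 2 * (1 + c) ^ 2 := by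
  have hK0 : 0 < K := by linarith
  have hc0 : 0 ≤ c := le_trans (abs_nonneg _) hγc
  have hγ2 : γ ^ 2 ≤ c ^ 2 := by rw [← sq_abs]; exact pow_le_pow_left₀ (abs_nonneg _) hγc 2
  have h1 : |γ * t| ≤ c := by
    rw [abs_mul]
    calc |γ| * |t| ≤ c * 1 := mul_le_mul hγc ht (abs_nonneg _) hc0
      _ = c := mul_one c
  have h2 : |γ / K| ≤ c := by
    rw [abs_div, abs_of_pos hK0, div_le_iff₀ hK0]; nlinarith [abs_nonneg γ]
  have h3 : |(y + 1) * r| ≤ 2 * c ^ 2 := by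
    rw [abs_mul]
    calc |y + 1| * |r| ≤ (K + 1) * (γ / K) ^ 2 := mul_le_mul hy hr (abs_nonneg _) (by positivity)
      _ = (K + 1) / K ^ 2 * γ ^ 2 := by rw [div_pow]; ring
      _ ≤ 2 * c ^ 2 := by
          have : (K + 1) / K ^ 2 ≤ 2 := by rw [div_le_iff₀ (by positivity)]; nlinarith
          exact mul_le_mul this hγ2 (sq_nonneg _) (by norm_num)
  calc |1 + γ * t + γ / K + (y + 1) * r| ≤ |1 + γ * t + γ / K| + |(y + 1) * r| := abs_add_le _ _
    _ ≤ (|1 + γ * t| + |γ / K|) + 2 * c ^ 2 := add_le_add (abs_add_le _ _) h3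
    _ ≤ ((1 + |γ * t|) + |γ / K|) + 2 * c ^ 2 := by
        have h := abs_add_le (1 : ℝ) (γ * t)
        rw [abs_one] at h
        linarith
    _ ≤ ((1 + c) + c) + 2 * c ^ 2 := by linarith
    _ ≤ 2 * (1 + c) ^ 2 := by nlinarith

end PairEigen

end Summit.Ventures.LatticeQCDFlow.Scaling

end
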